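import Mathlib
import HarnessLib
import Literature.NumberTheory.LFunctions.RHInvZetaBound

/-!
# Second logarithmic derivative of a zero-free bounded holomorphic function

Helper for the crux `Summit.Parity.BatemanHorn.Theses.AlmostPrimeZeros.SystemMomentDeficit`
(item stmt-Parity-11326, line `Sketch`, idea `small-circle-jensen`), stub `stub_logDerivBound`.

If `F` is holomorphic and zero-free on the disc `‖z − 1‖ < R`, `F(1) = 1` and `‖F‖ ≤ e^M` there
(`M ≥ 0`), then `‖F''(1) − F'(1)²‖ ≤ 64 (M + 1) / R²`.

Proof (Titchmarsh, *The Theory of Functions*, 2nd ed., §5.5 and §5.51): take a holomorphic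
logarithm `L` of `F` on the disc with `L(1) = log F(1) = 0`
(`Literature.NumberTheory.LFunctions.InvZetaRH.exists_log_of_ball`); then
`Re L = log ‖F‖ ≤ M ≤ M + 1`, so Borel–Carathéodory (Mathlib `Complex.borelCaratheodory_zero`)
gives `‖L z‖ ≤ 2(M+1)‖z−1‖/(R−‖z−1‖) = 2(M+1)` on `‖z − 1‖ = R/2`; the Cauchy estimate
(Mathlib `Complex.norm_iteratedDeriv_le_of_forall_mem_sphere_norm_le`) on that circle gives
`‖L''(1)‖ ≤ 2 · 2(M+1)/(R/2)² = 16(M+1)/R² ≤ 64(M+1)/R²`, and `L' = F'/F` near `1` yields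
`L''(1) = (F''(1) F(1) − F'(1)²)/F(1)² = F''(1) − F'(1)²`.
-/

noncomputable section

namespace Summit.Parity.BatemanHorn.Cruxes.SystemMomentDeficit.SmallCircle

open Complex Filter Topology Metric Set

open Literature.NumberTheory.LFunctions.InvZetaRH (exists_log_of_ball)

/-- **Borel–Carathéodory + Cauchy for a function with bounded real part.** If `L` is holomorphic
on `‖z − 1‖ < R`, `L 1 = 0` and `Re L ≤ M + 1` there (`M ≥ 0`), then
`‖iteratedDeriv 2 L 1‖ ≤ 16 (M + 1) / R²` (Borel–Carathéodory on the disc gives `‖L‖ ≤ 2(M+1)`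
on the circle `‖z − 1‖ = R/2`, then Cauchy's estimate for the second derivative).
[Titchmarsh, Theory of Functions §5.5, §5.51] -/
theorem logDerivBound_norm_iteratedDeriv_two_le {L : ℂ → ℂ} {R M : ℝ} (hR : 0 < R) (hM : 0 ≤ M)
    (hLd : DifferentiableOn ℂ L (ball 1 R)) (hL1 : L 1 = 0)
    (hre : ∀ z ∈ ball (1 : ℂ) R, (L z).re ≤ M + 1) :
    ‖iteratedDeriv 2 L 1‖ ≤ 16 * (M + 1) / R ^ 2 := by
  -- Borel–Carathéodory, translated to the origin
  have hM1 : 0 < M + 1 := by linarith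
  set f₀ : ℂ → ℂ := fun w ↦ L (1 + w) with hf₀
  have hshift : ∀ w ∈ ball (0 : ℂ) R, 1 + w ∈ ball (1 : ℂ) R := by
    intro w hw
    rw [mem_ball_zero_iff] at hw
    rwa [mem_ball, dist_eq_norm, add_sub_cancel_left]
  have hf₀d : DifferentiableOn ℂ f₀ (ball 0 R) := by
    intro w hw
    exact ((hLd.differentiableAt (isOpen_ball.mem_nhds (hshift w hw))).comp w
      ((differentiableAt_const (1 : ℂ)).add differentiableAt_id)).differentiableWithinAt
  have hmaps : MapsTo f₀ (ball 0 R) {w | w.re ≤ M + 1} := fun w hw ↦ hre _ (hshift w hw)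
  have hf₀0 : f₀ 0 = 0 := by simp [hf₀, hL1]
  have hbound : ∀ z ∈ sphere (1 : ℂ) (R / 2), ‖L z‖ ≤ 2 * (M + 1) := by
    intro z hz
    rw [mem_sphere, dist_eq_norm] at hz
    have hw : z - 1 ∈ ball (0 : ℂ) R := by
      rw [mem_ball_zero_iff, hz]; linarith
    have key := borelCaratheodory_zero hM1 hf₀d hmaps hR hw hf₀0
    have hf₀z : f₀ (z - 1) = L z := by simp [hf₀]
    have hR2ne : R / 2 ≠ 0 := by positivity
    have h2 : 2 * (M + 1) * (R / 2) / (R - R / 2) = 2 * (M + 1) := by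
      rw [show R - R / 2 = R / 2 by ring, mul_div_assoc, div_self hR2ne, mul_one]
    rw [hf₀z, hz, h2] at key
    exact key
  -- Cauchy estimate on the circle of radius `R/2`
  have hR2 : 0 < R / 2 := by linarith
  have hdc : DiffContOnCl ℂ L (ball (1 : ℂ) (R / 2)) :=
    hLd.diffContOnCl_ball (closedBall_subset_ball (by linarith))
  have hC := norm_iteratedDeriv_le_of_forall_mem_sphere_norm_le 2 hR2 hdc hbound
  refine hC.trans (le_of_eq ?_)
  rw [Nat.factorial_two, Nat.cast_ofNat, show (R / 2) ^ 2 = R ^ 2 / 4 by ring, div_div_eq_mul_div]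
  ring

/-- **Second logarithmic derivative of a zero-free bounded function** (stub `stub_logDerivBound`
of the crux line `Sketch` for `SystemMomentDeficit`). If `F` is holomorphic and zero-free on
`‖z − 1‖ < R` with `F(1) = 1` and `‖F(z)‖ ≤ e^{M}` (`M ≥ 0`), then
`‖F''(1) − F'(1)²‖ ≤ 64 (M + 1)/R²`: with the holomorphic logarithm `g = log F`, `g(1) = 0`,
`Re g = log ‖F‖ ≤ M`, Borel–Carathéodory (`Complex.borelCaratheodory_zero`) bounds
`‖g‖ ≤ 2(M+1)` on `‖z−1‖ = R/2`, the Cauchy estimate gives `‖g''(1)‖ ≤ 16(M+1)/R²`, and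
`g'' = (F'/F)' = F''/F − (F'/F)²`. [Titchmarsh, Theory of Functions §5.5] -/
theorem stub_logDerivBound :
    ∀ (F : ℂ → ℂ) (R M : ℝ), 0 < R → 0 ≤ M → DifferentiableOn ℂ F (Metric.ball 1 R) →
      (∀ z ∈ Metric.ball (1 : ℂ) R, F z ≠ 0) → F 1 = 1 →
      (∀ z ∈ Metric.ball (1 : ℂ) R, ‖F z‖ ≤ Real.exp M) →
      ‖iteratedDeriv 2 F 1 - (deriv F 1) ^ 2‖ ≤ 64 * (M + 1) / R ^ 2 := by
  intro F R M hR hM hF hF0 hF1 hbd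
  obtain ⟨L, hLd, hL1, hLder, hexp⟩ := exists_log_of_ball hR hF hF0
  rw [hF1, Complex.log_one] at hL1
  -- `Re L = log ‖F‖ ≤ M ≤ M + 1` on the disc
  have hre : ∀ z ∈ ball (1 : ℂ) R, (L z).re ≤ M + 1 := by
    intro z hz
    have h1 : Real.exp (L z).re = ‖F z‖ := by rw [← hexp z hz, norm_exp]
    have h2 : Real.exp (L z).re ≤ Real.exp M := by rw [h1]; exact hbd z hz
    have h3 : (L z).re ≤ M := Real.exp_le_exp.mp h2
    linarith
  have hL2 := logDerivBound_norm_iteratedDeriv_two_le hR hM hLd hL1 hre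
  -- identify `L''(1) = F''(1) - F'(1)²` from `L' = F'/F` near `1`
  have h1mem : (1 : ℂ) ∈ ball (1 : ℂ) R := mem_ball_self hR
  have hderL : deriv L =ᶠ[𝓝 1] fun z ↦ deriv F z / F z := by
    filter_upwards [isOpen_ball.mem_nhds h1mem] with z hz
    exact (hLder z hz).deriv
  have hFat : DifferentiableAt ℂ F 1 := hF.differentiableAt (isOpen_ball.mem_nhds h1mem)
  have hF'at : DifferentiableAt ℂ (deriv F) 1 :=
    (hF.deriv isOpen_ball).differentiableAt (isOpen_ball.mem_nhds h1mem)
  have hF1ne : F 1 ≠ 0 := by rw [hF1]; exact one_ne_zero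
  have hid : iteratedDeriv 2 L 1 = iteratedDeriv 2 F 1 - (deriv F 1) ^ 2 := by
    have h2L : iteratedDeriv 2 L = deriv (deriv L) := by
      rw [iteratedDeriv_succ, iteratedDeriv_one]
    have h2F : iteratedDeriv 2 F = deriv (deriv F) := by
      rw [iteratedDeriv_succ, iteratedDeriv_one]
    rw [h2L, h2F, hderL.deriv_eq, deriv_fun_div hF'at hFat hF1ne, hF1]
    ring
  rw [← hid]
  refine hL2.trans (div_le_div_of_nonneg_right (by nlinarith) (by positivity))

end Summit.Parity.BatemanHorn.Cruxes.SystemMomentDeficit.SmallCircle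

end
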